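import Literature.MathematicalPhysics.QuantumFieldTheory.Balaban1983to89.B4Ineq53RegularRegion
import Literature.MathematicalPhysics.QuantumFieldTheory.Balaban1983to89.B4Prop23BlockAvg
import Literature.MathematicalPhysics.QuantumFieldTheory.Balaban1983to89.B4RegionCov1518

/-!
# `Balaban1983to89.B4Prop23RegularRegion` — T. Bałaban, *Regularity and decay of lattice Green's functions*, Commun.
# Math. Phys. **89** (1983) 571–597 [Balaban1983RegularityDecay] (= B4), «Proposition 2.3 of [1]» p. 574: the kernel
# bounds (1.16) and (1.17)–(1.18) for `C^{(k)}_Λ(Ω,A)` PROVED AT A REGULAR `A ≠ 0`, for EVERY `Λ`, on every finite union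
# of `L`-blocks, by the printed §5 route (5.3)–(5.4) ⇒ Sect. 5 Theorem (pp. 593–594)

statement-level skeleton of published theorems with citation tags; proofs where landed; nothing here is a claim about the Yang–Mills mass gap

PDF held: `paper:balaban1983-cmp89-regularity-decay` (journal page = PDF page + 570); pp. 573–574, 580, 593–594 [PDF
3–4, 10, 23–24] read on the ×2 renders `…/b2b-balaban-ref1/pages/1983-cmp89-regularity-decay/…-p0NN-x2.png`.

CITATION HEADER (lean-in-tree rule).  Cell `lit-balaban` (HOME `run/shared/lean/pub/lit-balaban/`), Phase-2 proof seat
**p17** gen 3 (unit `lit-balaban-p17-g3`), file 3 of the MODEL INSTANCE of SKELETON row **B4.Prop2.3[I]**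
(`B4.Prop23Printed`, owner r01, referee ref-4) AT A REGULAR `A ≠ 0`: clauses (1.16) and (1.17)–(1.18).  This file only
COMPOSES landed theorems: r01's §5 route `B4Prop23Sect5Route.prop23_116_118_of_cor23` («Proposition I.2.3 is a
consequence of the following Theorem», the Sect. 5 Theorem being kernel-proved in `B4Sect5Torus`), its input (5.3) =
`B4Ineq53RegularRegion.form115_lower_regular` (file 2/3), its input (5.4)/Corollary 2.3 at `A ≠ 0` =
`B4Cor23Rep36Bridge.hG_regularPair` (p17 gen 2, from b04's `B4Cor23Region`), and the structure of the block averagings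
`Q_k(A)` (`B4Cor23Rep36Bridge.{QkR, qkR_off, qkR_diag, card_blkR, trn_mul_transpose, bl2n_sq}`,
`B4Sect3BlockAveraging.avgOp_mul_transpose`) and `P(A)` (`B4NextAvg52.{nextAvg, rowOrtho_nextAvg,
pOp_nextAvg_apply_ne_zero}`, `B4Prop23BlockAvg.abs_pOp_le_one`); the unit-lattice geometry is b04's
(`B4RegionCov1518.{rhoS, rhoS_isPseudoDist, rhoS_sumBound, edistR_ge_supNorm_blk}`, `B4BoxCov237.supNorm_sub_le_of_blk_eq`).

WHAT IS PRINTED (p. 574 [PDF 4], verbatim): *"Proposition 2.3 of [1]. There exist positive constants δ₀, c₀, γ₀, γ₁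
dependent on d and M only and such that for arbitrary Λ ⊂ Ω^{(k)} = Ω∩Z^d, Λ being a sum of big blocks and for e
sufficiently small, we have γ₀I ≤ Δ^{(k)}(Ω,A) + aL^{−2}P(A) ≤ γ₁I, (1.15) |C^{(k)}_Λ(Ω,A; x,x′)| ≤ c₀exp(−δ₀|x−x′|),
x, x′ ∈ Λ. (1.16) In particular the above inequality holds for C^{(k)}(Ω,A). Putting δC^{(k)}_Λ(Ω,A) = C^{(k)}_Λ(Ω,A) −
C^{(k)}(Ω,A), (1.17) we have also |δC^{(k)}_Λ(Ω,A; x,x′)| ≤ c₀exp(−δ₀(|x−x′| + dist(x,Λ^c) + dist(x′,Λ^c))), x, x′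
∈ Λ. (1.18)"*; p. 594 [PDF 24]: *"From these properties it follows that Proposition I.2.3 is a consequence of the
following Theorem."*

DICTIONARY (as files 1–2; lattice units, `d ↦ d+1`).  `Y = Ω^{(k)} × {colours}` (`↥(fineDom L Zc) × ι`), `Λ ⊂ Y` an
ARBITRARY finite set of site–colour pairs (the printed `Λ ⊂ Ω^{(k)}` is `Λ × {colours}`; «a sum of big blocks» is NOT
needed on this route); `C^{(k)}_Λ(Ω,A) = ((Δ^{(k)}(Ω,A) + a′L^{−2}P(A))|_Λ)^{−1}` = r01's `cLam (hamR …) a_k (QkR …) a′ L^{−2}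
L^{d+1} (nextAvg …) Λ` ((1.13), `X|_Λ = ΛXΛ`); `C^{(k)}(Ω,A)` = the full inverse (`Λ = Y`); `|x − x′|` ↦ `|·|_∞` of the
sites (`rhoY`); `dist(x,Λ^c)` ↦ any boundary weight `β ≥ 0` with `β(y) ≤ |y − z|_∞` for `z ∉ Λ` (e.g. b04's `distCS`);
the matrix entries of the `R^N ⊗ R^N`-valued kernels are bounded one by one.

WHAT IS KERNEL-CHECKED (zero `sorry`, standard axioms; no `Prop`-valued definition): §1 the unit-lattice geometry of
r01's route DISCHARGED — `rhoY` (+ pseudo-distance, lattice-sum profile `profK = N·K_{d+1}`), the block supports `suppK` of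
the rows of `Q_k(A)` (`QkR_row_support`), their unit square norms (`QkR_row_sq`), `rhoY ≤ dist_η(blocks) + L`
(`rhoY_le_sdistR`), `P(A;y,y′) ≠ 0 ⇒ |y−y′|_∞ ≤ L` (`rhoY_le_of_pOp_ne_zero`); §2 **`prop23_116_118_regular`** — (1.16)
AND (1.17)–(1.18) AT A REGULAR `A ≠ 0` FOR EVERY `Λ ⊆ Y`: for every mesh `n ≥ 1`, every `L ≥ 1`, every finite union
`Ω^{(k)}` of `L`-blocks, every `m² ∈ [0,m²₊]`, every vector field with (1.7) `|A_ν(x+e_μ) − A_ν(x)| ≤ c·e^{β−1}/n` on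
`Ω`, `e` small (`hsmall`, `hsmallU`, `hX` of file 2): `|C^{(k)}_Λ(Ω,A;y,y′)| ≤ c₁e^{−δ₁|y−y′|_∞}` and
`|C^{(k)}_Λ(Ω,A;y,y′) − C^{(k)}(Ω,A;y,y′)| ≤ c₁e^{−δ₁(|y−y′|_∞ + β(y) + β(y′))}` with the EXPLICIT `c₁ = c116`,
`δ₁ = d116` (r01's `cSt`/`dSt` of the Sect. 5 Theorem at `γ₀ = γ₀″` of file 2, `c₀ = (a_k²c₀(a) + a′L^{−2} + a_k)e^{δ₀(d,a)L}`,
`δ₀ = δ₀(d,a)` of b04's Corollary 2.3).  Clause (1.19)–(1.20) is the sibling `B4Ineq120RegularRegion`; the typed leaf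
`B4.Prop23Printed` on the regular-field family is `B4Prop23RegularFamily`.  Unit `lit-balaban-p17-g3`, HOME as above.
-/

namespace Literature.MathematicalPhysics.QuantumFieldTheory.Balaban1983to89.B4Prop23RegularRegion

open Finset Matrix
open Literature.MathematicalPhysics.QuantumFieldTheory.Balaban1983to89
open Literature.MathematicalPhysics.QuantumFieldTheory.Balaban1983to89.B4GaugeCovariance (OrthFlow avgOp)
open Literature.MathematicalPhysics.QuantumFieldTheory.Balaban1983to89.B4Lower18Regular (e1)
open Literature.MathematicalPhysics.QuantumFieldTheory.Balaban1983to89.B4Lower18RegularRegion (rbaseEmb rbaseEmb_blk)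
open Literature.MathematicalPhysics.QuantumFieldTheory.Balaban1983to89.B4Reflection242 (blk)
open Literature.MathematicalPhysics.QuantumFieldTheory.Balaban1983to89.B4Lower18 (fineDom edistR)
open Literature.MathematicalPhysics.QuantumFieldTheory.Balaban1983to89.B4ContourShift (supNorm supNorm_nonneg)
open Literature.MathematicalPhysics.QuantumFieldTheory.Balaban1983to89.B4Cor23ZeroDelta (setDist)
open Literature.MathematicalPhysics.QuantumFieldTheory.Balaban1983to89.B4Cor23Region (bl2n c0R delta0R c0R_pos
  delta0R_pos)
open Literature.MathematicalPhysics.QuantumFieldTheory.Balaban1983to89.B4RegionCov1518 (rhoS rhoS_isPseudoDist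
  rhoS_sumBound edistR_ge_supNorm_blk)
open Literature.MathematicalPhysics.QuantumFieldTheory.Balaban1983to89.B4BoxCov237 (supNorm_sub_le_of_blk_eq)
open Literature.MathematicalPhysics.QuantumFieldTheory.Balaban1983to89.B4Sect5Proof (latticeConst latticeConst_nonneg)
open Literature.MathematicalPhysics.QuantumFieldTheory.Balaban1983to89.B4Sect5Torus (IsPseudoDist SumBound cSt dSt)
open Literature.MathematicalPhysics.QuantumFieldTheory.Balaban1983to89.B4GaussRep36 (pOp cLam RowOrtho)
open Literature.MathematicalPhysics.QuantumFieldTheory.Balaban1983to89.B4Sect3BlockAveraging (avgOp_apply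
  avgOp_mul_transpose)
open Literature.MathematicalPhysics.QuantumFieldTheory.Balaban1983to89.B4Prop23BlockAvg (abs_pOp_le_one)
open Literature.MathematicalPhysics.QuantumFieldTheory.Balaban1983to89.B4Prop23Sect5Route (prop23_116_118_of_cor23)
open Literature.MathematicalPhysics.QuantumFieldTheory.Balaban1983to89.B4Cor23Rep36Bridge (hamR qkR QkR blkR qkR_off
  qkR_diag card_blkR trn_mul_transpose hamR_isSymm bl2n_sq sdistR hG_regularPair)
open Literature.MathematicalPhysics.QuantumFieldTheory.Balaban1983to89.B4Cor23RegionDeltaAlg (trn)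
open Literature.MathematicalPhysics.QuantumFieldTheory.Balaban1983to89.B4NextAvg52 (nextAvg rowOrtho_nextAvg
  pOp_nextAvg_apply_ne_zero)
open Literature.MathematicalPhysics.QuantumFieldTheory.Balaban1983to89.B4Ineq53RegularRegion (gam0 gamLow gamLow_pos
  form115_lower_regular)

noncomputable section

variable {d : ℕ} {ι : Type} [Fintype ι] [DecidableEq ι]

/-! ## §1. The unit-lattice geometry of r01's §5 route, discharged on the regular-field region data -/

section Geometry

variable {L : ℕ} (hL : 1 ≤ L) (Zc : Finset (Fin (d + 1) → ℤ))

/-- `|y − y′|_∞` on `Y = Ω^{(k)} × {colours}` (the `|x − x′|` of (1.16)/(1.18), colour-blind).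
[cite: Balaban1983RegularityDecay, (1.16) p.574] -/
def rhoY (L : ℕ) (Zc : Finset (Fin (d + 1) → ℤ)) (p q : ↥(fineDom L Zc) × ι) : ℝ := rhoS (fineDom L Zc) p.1 q.1

/-- the lattice-sum profile of `Y`: `N·K_{d+1}` (b04's `latticeConst`). [cite: Balaban1983RegularityDecay, Sect. 5 Theorem p.594] -/
def profK (ι : Type) [Fintype ι] (d : ℕ) (t : ℝ) : ℝ := Fintype.card ι * latticeConst (d + 1) t

omit [Fintype ι] [DecidableEq ι] in
/-- `|·|_∞` on `Y` is a pseudo-distance. [cite: Balaban1983RegularityDecay, (1.16) p.574] -/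
theorem rhoY_isPseudoDist : IsPseudoDist (rhoY (ι := ι) L Zc) where
  symm := fun p q => (rhoS_isPseudoDist (fineDom L Zc)).symm p.1 q.1
  zero := fun p => (rhoS_isPseudoDist (fineDom L Zc)).zero p.1
  triangle := fun p q r => (rhoS_isPseudoDist (fineDom L Zc)).triangle p.1 q.1 r.1

omit [DecidableEq ι] in
/-- uniform lattice sums on `Y`: `Σ_{y′} e^{−t|y−y′|_∞} ≤ N·K_{d+1}(t)`. [cite: Balaban1983RegularityDecay, Sect. 5 Theorem p.594] -/
theorem rhoY_sumBound : SumBound (rhoY (ι := ι) L Zc) (profK ι d) := by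
  intro t ht p
  rw [Fintype.sum_prod_type]
  simp only [rhoY, Finset.sum_const, Finset.card_univ, nsmul_eq_mul, profK]
  rw [← Finset.mul_sum]
  exact mul_le_mul_of_nonneg_left (rhoS_sumBound (fineDom L Zc) t ht p.1) (Nat.cast_nonneg _)

omit [DecidableEq ι] in
/-- the profile is non-negative. [cite: Balaban1983RegularityDecay, Sect. 5 Theorem p.594] -/
theorem profK_nonneg (t : ℝ) (ht : 0 < t) : 0 ≤ profK ι d t :=
  mul_nonneg (Nat.cast_nonneg _) (latticeConst_nonneg (d + 1) ht.le)

variable {n : ℕ} (hn : 1 ≤ n)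

/-- the support set `S_y = B^k(y) × {colours}` of the row `y` of `Q_k(A)` (the fine points of the block of `y`).
[cite: Balaban1983RegularityDecay, (1.4) p.572, (3.7) p.588] -/
def suppK (p : ↥(fineDom L Zc) × ι) : Finset (↥(fineDom n (fineDom L Zc)) × ι) :=
  univ.filter fun r => blkR hn (fineDom L Zc) r.1 = p.1

variable (F : OrthFlow ι) (e : ℝ) (Ac : (Fin (d + 1) → ℤ) → Fin (d + 1) → ℝ)

/-- `hS`: the row `y` of `Q_k(A)` is supported in `B^k(y)`. [cite: Balaban1983RegularityDecay, (1.4) p.572] -/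
theorem QkR_row_support (p : ↥(fineDom L Zc) × ι) (r : ↥(fineDom n (fineDom L Zc)) × ι) (hr : r ∉ suppK Zc hn p) :
    QkR F e hn (fineDom L Zc) Ac p r = 0 := by
  have hne : blkR hn (fineDom L Zc) r.1 ≠ p.1 := fun h => hr (Finset.mem_filter.2 ⟨Finset.mem_univ _, h⟩)
  show qkR n (fineDom L Zc) p.1 r.1 * trn F e hn (fineDom L Zc) Ac p.1 r.1 p.2 r.2 = 0
  rw [qkR_off hn (fineDom L Zc) p.1 r.1 hne, zero_mul]

/-- `hT`: the rows of `Q_k(A)` have square norm `1` (*"The L²-norms of the functions q_k(y) … are equal to 1"*, p. 588).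
[cite: Balaban1983RegularityDecay, (1.4) p.572, p.588] -/
theorem QkR_row_sq (p : ↥(fineDom L Zc) × ι) :
    (fun r => QkR F e hn (fineDom L Zc) Ac p r) ⬝ᵥ (fun r => QkR F e hn (fineDom L Zc) Ac p r) ≤ 1 := by
  have hn0 : (0 : ℝ) < n := by exact_mod_cast hn
  have hs : (0 : ℝ) ≤ ((n : ℝ) ^ (d + 1))⁻¹ := by positivity
  have M := avgOp_mul_transpose (blkR hn (fineDom L Zc)) (qkR n (fineDom L Zc))
    (trn F e hn (fineDom L Zc) Ac) (Real.sqrt (((n : ℝ) ^ (d + 1))⁻¹)) (n ^ (d + 1))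
    (qkR_off hn (fineDom L Zc)) (qkR_diag hn (fineDom L Zc)) (card_blkR hn (fineDom L Zc))
    (fun x => trn_mul_transpose F e hn (fineDom L Zc) Ac (blkR hn (fineDom L Zc) x) x)
  have h := congrFun (congrFun M p) p
  rw [Matrix.mul_apply] at h
  simp only [Matrix.transpose_apply, Matrix.smul_apply, Matrix.one_apply_eq, smul_eq_mul, mul_one] at h
  have hval : Real.sqrt (((n : ℝ) ^ (d + 1))⁻¹) ^ 2 * ((n ^ (d + 1) : ℕ) : ℝ) = 1 := by
    rw [Real.sq_sqrt hs]
    push_cast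
    exact inv_mul_cancel₀ (by positivity)
  unfold dotProduct
  rw [show (∑ r, QkR F e hn (fineDom L Zc) Ac p r * QkR F e hn (fineDom L Zc) Ac p r)
      = ∑ r, avgOp (qkR n (fineDom L Zc)) (trn F e hn (fineDom L Zc) Ac) p r
          * avgOp (qkR n (fineDom L Zc)) (trn F e hn (fineDom L Zc) Ac) p r from rfl, h, hval]

/-- a lower bound for the set distance from a pointwise lower bound (non-empty sets). [folklore] -/
private theorem le_setDist {α : Type*} (dR : α → α → ℝ) {A B : Finset α} {m : ℝ} (hne : (A ×ˢ B).Nonempty)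
    (h : ∀ x ∈ A, ∀ y ∈ B, m ≤ dR x y) : m ≤ setDist dR A B := by
  unfold setDist
  rw [dif_pos hne]
  exact Finset.le_inf' _ _ fun q hq => h q.1 (Finset.mem_product.1 hq).1 q.2 (Finset.mem_product.1 hq).2

omit [DecidableEq ι] in
include hL in
/-- `hρS`: `|y − y′|_∞ ≤ dist_η(B^k(y), B^k(y′)) + L` (block geometry: the unit blocks have `η`-diameter `< 1 ≤ L`).
[cite: Balaban1983RegularityDecay, (1.4) p.572, (5.4) p.593] -/
theorem rhoY_le_sdistR (p q : ↥(fineDom L Zc) × ι) :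
    rhoY L Zc p q ≤ sdistR n (fineDom L Zc) (suppK Zc hn p) (suppK Zc hn q) + L := by
  have hL1 : (1 : ℝ) ≤ L := by exact_mod_cast hL
  have hmem : ∀ (s : ↥(fineDom L Zc) × ι), (rbaseEmb hn (fineDom L Zc) s.1) ∈ (suppK Zc hn s).image Prod.fst :=
    fun s => Finset.mem_image.2 ⟨(rbaseEmb hn (fineDom L Zc) s.1, s.2),
      Finset.mem_filter.2 ⟨Finset.mem_univ _, Subtype.ext (rbaseEmb_blk hn (fineDom L Zc) s.1)⟩, rfl⟩
  have hlow : rhoY L Zc p q - 1 ≤ sdistR n (fineDom L Zc) (suppK Zc hn p) (suppK Zc hn q) := by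
    refine le_setDist _ ⟨_, Finset.mk_mem_product (hmem p) (hmem q)⟩ fun x hx t ht => ?_
    obtain ⟨r, hr, rfl⟩ := Finset.mem_image.1 hx
    obtain ⟨s, hs, rfl⟩ := Finset.mem_image.1 ht
    have hr' : blk n r.1.1 = p.1.1 := congrArg Subtype.val (Finset.mem_filter.1 hr).2
    have hs' : blk n s.1.1 = q.1.1 := congrArg Subtype.val (Finset.mem_filter.1 hs).2
    have h := edistR_ge_supNorm_blk hn (fineDom n (fineDom L Zc)) r.1 s.1
    rw [hr', hs'] at h
    exact h
  linarith

/-- `hρP`: `P(A;y,y′) ≠ 0 ⇒ |y − y′|_∞ ≤ L` (same `L`-block). [cite: Balaban1983RegularityDecay, (5.2) p.593, (1.15) p.574] -/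
theorem rhoY_le_of_pOp_ne_zero (p q : ↥(fineDom L Zc) × ι)
    (h : pOp (((L ^ (d + 1) : ℕ) : ℝ)) (nextAvg F (e / n) hL Zc n Ac) p q ≠ 0) : rhoY L Zc p q ≤ L := by
  have h1 := supNorm_sub_le_of_blk_eq hL (pOp_nextAvg_apply_ne_zero F (e / n) hL Zc n Ac h)
  unfold rhoY rhoS
  linarith

end Geometry

/-! ## §2. (1.16) and (1.17)–(1.18) at a regular `A ≠ 0`, for every `Λ` -/

/-- the (5.6)-constant `c₀ = (a_k²·c₀(a) + a′L^{−2} + a_k)e^{δ₀(d,a)L}` of (5.4) at a regular field (r01's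
`abs_kOp_apply_le_exp` with b04's Corollary-2.3 constants). [cite: Balaban1983RegularityDecay, (5.4) p.593] -/
def c54 (d L : ℕ) (a a' : ℝ) : ℝ :=
  (a ^ 2 * (c0R a * (1 * 1)) + a' * ((L : ℝ) ^ 2)⁻¹ + a) * Real.exp (delta0R d a * L)

/-- the constant `c₁` of (1.16)/(1.18) at a regular field: the Sect. 5 Theorem's `cSt` at `(γ₀″, c₀, δ₀)`.
[cite: Balaban1983RegularityDecay, (1.16) p.574, Sect. 5 Theorem p.594] -/
def c116 (ι : Type) [Fintype ι] (d L : ℕ) (a a' m2max : ℝ) : ℝ :=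
  cSt (profK ι d) (gamLow d L a a' m2max) (c54 d L a a') (delta0R d a)

/-- the rate `δ₁` of (1.16)/(1.18) at a regular field: the Sect. 5 Theorem's `dSt` at `(γ₀″, c₀, δ₀)`.
[cite: Balaban1983RegularityDecay, (1.16) p.574, Sect. 5 Theorem p.594] -/
def d116 (ι : Type) [Fintype ι] (d L : ℕ) (a a' m2max : ℝ) : ℝ :=
  dSt (profK ι d) (gamLow d L a a' m2max) (c54 d L a a') (delta0R d a)

section Main

variable (F : OrthFlow ι) {ℓ : ℝ} (hℓ : 0 ≤ ℓ)
  (hLip : ∀ t (v : ι → ℝ), ((F.U t - 1) *ᵥ v) ⬝ᵥ ((F.U t - 1) *ᵥ v) ≤ (ℓ * t) ^ 2 * (v ⬝ᵥ v))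
  {e : ℝ} (he : 0 < e) {n L : ℕ} (hn : 1 ≤ n) (hL : 1 ≤ L) {a : ℝ} (ha : 0 < a) {a' : ℝ} (ha' : 0 < a')
  {m2 m2max : ℝ} (hm : 0 ≤ m2) (hmm : m2 ≤ m2max) (Zc : Finset (Fin (d + 1) → ℤ))
  {Ac : (Fin (d + 1) → ℤ) → Fin (d + 1) → ℝ} {c β : ℝ} (hc : 0 ≤ c)
  (h17 : ∀ x ∈ fineDom n (fineDom L Zc), ∀ μ ν : Fin (d + 1), |Ac (x + e1 μ) ν - Ac x ν| ≤ c * e ^ (β - 1) / n)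
  (hsmall : ℓ ^ 2 * ((d + 1) * c * e ^ β) ^ 2 * (d + 1) * (1 + a * (d + 1)) ≤ min 2 a / 4)
  (hsmallU : ℓ ^ 2 * ((d + 1) * ((L : ℝ) ^ 2 * c) * e ^ β) ^ 2 * (d + 1)
      * (1 + (a' / gam0 d a m2max) * (d + 1)) ≤ min 2 (a' / gam0 d a m2max) / 4)
  (hX : gam0 d a m2 * (6 * (d + 1) * (a / (min 2 a / 4 + m2)) ^ 2 * (ℓ * ((3 * d + 4) * c * e ^ β)) ^ 2)
      ≤ gamLow d L a a' m2max)

include hℓ hLip he ha ha' hm hmm hc h17 hsmall hsmallU hX in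
/-- **B4 (1.16) AND (1.17)–(1.18) AT A REGULAR `A ≠ 0`, EVERY `Λ`** (p. 574: *"|C^{(k)}_Λ(Ω,A; x,x′)| ≤ c₀exp(−δ₀|x−x′|),
x, x′ ∈ Λ. (1.16) … |δC^{(k)}_Λ(Ω,A; x,x′)| ≤ c₀exp(−δ₀(|x−x′| + dist(x,Λ^c) + dist(x′,Λ^c))), x, x′ ∈ Λ. (1.18)"*):
for every mesh `n ≥ 1`, `L ≥ 1`, every finite union `Ω^{(k)}` of `L`-blocks of unit sites (labels `Zc = Ω^{(k+1)}`), every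
`m² ∈ [0,m²₊]`, every vector field with (1.7) `|A_ν(x+e_μ) − A_ν(x)| ≤ c·e^{β−1}/n` on `Ω` and `e` small (`hsmall`,
`hsmallU`, `hX`), and EVERY finite `Λ ⊆ Ω^{(k)} × {colours}`: the entries of `C^{(k)}_Λ(Ω,A) = ((Δ^{(k)}(Ω,A) +
a′L^{−2}P(A))|_Λ)^{−1}` satisfy (1.16) with `|x−x′| = |·|_∞` and (1.17)–(1.18) for every admissible boundary weight `β`
(`0 ≤ β`, `β(y) ≤ |y−z|_∞` for `z ∉ Λ`), constants `c₁ = c116`, `δ₁ = d116` — by the PRINTED §5 ROUTE pp. 593–594: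
(5.3) (`form115_lower_regular`), (5.4) from Corollary 2.3 at `A ≠ 0` (`hG_regularPair`), and the Sect. 5 Theorem
(r01's `prop23_116_118_of_cor23`). [cite: Balaban1983RegularityDecay, Prop. 2.3 of [1] (1.16)–(1.18) p.574, (5.3)–(5.4) p.593, Sect. 5 Theorem p.594] -/
theorem prop23_116_118_regular (Λ : Finset (↥(fineDom L Zc) × ι)) :
    (∀ y y' : Λ, |cLam (hamR F e m2 (fineDom L Zc) Ac n) a (QkR F e hn (fineDom L Zc) Ac) a' (((L : ℝ) ^ 2)⁻¹)
        (((L ^ (d + 1) : ℕ) : ℝ)) (nextAvg F (e / n) hL Zc n Ac) Λ y y'|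
        ≤ c116 ι d L a a' m2max * Real.exp (-(d116 ι d L a a' m2max * rhoY L Zc y.1 y'.1))) ∧
    (∀ β : Λ → ℝ, (∀ y, 0 ≤ β y) → (∀ (y : Λ) (z : ↥(fineDom L Zc) × ι), z ∉ Λ → β y ≤ rhoY L Zc y.1 z) →
      ∀ y y' : Λ, |cLam (hamR F e m2 (fineDom L Zc) Ac n) a (QkR F e hn (fineDom L Zc) Ac) a' (((L : ℝ) ^ 2)⁻¹)
            (((L ^ (d + 1) : ℕ) : ℝ)) (nextAvg F (e / n) hL Zc n Ac) Λ y y'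
          - (B4GaussRep36.deltaK (hamR F e m2 (fineDom L Zc) Ac n) a (QkR F e hn (fineDom L Zc) Ac)
              + (a' * ((L : ℝ) ^ 2)⁻¹) • pOp (((L ^ (d + 1) : ℕ) : ℝ)) (nextAvg F (e / n) hL Zc n Ac))⁻¹ y y'|
        ≤ c116 ι d L a a' m2max *
          Real.exp (-(d116 ι d L a a' m2max * (rhoY L Zc y.1 y'.1 + β y + β y')))) := by
  have hL0 : (0 : ℝ) < L := by exact_mod_cast hL
  have hw : (((L ^ (d + 1) : ℕ) : ℝ)) ≠ 0 := by
    have : 0 < L ^ (d + 1) := pow_pos hL _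
    exact_mod_cast this.ne'
  exact prop23_116_118_of_cor23 (K := profK ι d) (profK_nonneg (ι := ι)) (gamLow_pos d hL a ha' m2max)
    (rhoY_isPseudoDist (ι := ι) Zc) (rhoY_sumBound (ι := ι) Zc) (suppK Zc hn)
    (hamR_isSymm F e m2 (fineDom L Zc) Ac)
    (form115_lower_regular F hℓ hLip he hn hL ha ha' hm hmm Zc hc h17 hsmall hsmallU hX)
    (QkR_row_support Zc hn F e Ac) (QkR_row_sq Zc hn F e Ac) bl2n_sq zero_le_one (c0R_pos ha).le zero_le_one ha
    (by positivity) (hG_regularPair F hℓ hLip he hn ha hm (fineDom L Zc) hc h17 hsmall) (delta0R_pos d ha) hL0.le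
    (rhoY_le_sdistR hL Zc hn) (rhoY_le_of_pOp_ne_zero hL Zc F e Ac)
    (fun p q => abs_pOp_le_one (rowOrtho_nextAvg F (e / n) hL Zc n Ac) hw p q) Λ

end Main

end

end Literature.MathematicalPhysics.QuantumFieldTheory.Balaban1983to89.B4Prop23RegularRegion
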